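import Mathlib
import Literature.Probability.RandomPlanarGeometry.PolylineUniform
import Literature.Probability.RandomPlanarGeometry.CurveMonotoneReparam

/-!
# Gate transfer, helper 1: a polyline is close to its middle piece modulo reparametrisation

Support file for the stub `stub_gateTransfer` of the line `bridge-gate-renewal` (crux
`SAWDefectDecoherence.ObservableToSLER`, stmt-CriticalPhenomena-14005).  The assembly of that stub
compares the polyline of a self-avoiding walk `l₁ ++ mid ++ l₂` (prefix inside a small hexagon
around the starting point, suffix inside a small hexagon around the endpoint) with the polyline of
its middle piece `mid`, as points of the curve space `CurveClass` (curves modulo increasing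
reparametrisation).  The one geometric input is proved here, for an arbitrary real normed space:

* `dist_mk_polyline_append_le` — if every vertex of `P` is within `d` of the first vertex of `M`
  and every vertex of `S` is within `d` of the last vertex of `M`, then
  `dist (mk (polyline (P ++ M ++ S))) (mk (polyline M)) ≤ d`.

Proof: both polylines are their uniform parametrisations run with a dyadic clock
(`Polyline.polyline_apply_eq_uniform_clock`); the uniform parametrisation of `P ++ M ++ S`
restricted to the middle time window is the uniform parametrisation of `M`
(`uniform_append_of_le`, `uniform_append_of_length_le`); running `M` with the clamped clock of the
long list is a monotone reparametrisation, at distance `0`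
(`Curve.reparamDist_eq_zero_of_monotone'`), and pointwise the two runs differ only while the long
polyline is in its prefix (resp. suffix), where it stays in the closed `d`-ball about the first
(resp. last) vertex of `M` (`uniform_mem_of_convex`).  Elementary; tagged [folklore].
-/

noncomputable section

open Set Metric
open scoped unitInterval Topology

namespace Summit.CriticalPhenomena.SAWScalingLimit.Theorems.ObservableToSLER.BridgeGate

open Literature.Probability.RandomPlanarGeometry
open Literature.Probability.RandomPlanarGeometry.Polyline
open Literature.Probability.LatticeModels (polyline)

section Uniform

variable {E : Type*} [AddCommGroup E] [Module ℝ E] [TopologicalSpace E] [ContinuousAdd E]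
  [ContinuousSMul ℝ E]

/-- Before time `l.length` the uniform parametrisation of `l ++ l'` is that of `l`. [folklore] -/
theorem uniform_append_of_le : ∀ (l l' : List E) (a : E) {s : ℝ}, s ≤ l.length →
    uniform a (l ++ l') s = uniform a l s
  | [], l', a, s, hs => by
      rw [List.nil_append, uniform_nil, uniform_of_nonpos a l' (by simpa using hs)]
  | b :: l, l', a, s, hs => by
      rw [List.cons_append, uniform_cons, uniform_cons]
      split_ifs with h
      · rfl
      · have hs' : s - 1 ≤ l.length := by
          simp only [List.length_cons, Nat.cast_add, Nat.cast_one] at hs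
          linarith
        exact uniform_append_of_le l l' b hs'

/-- After time `l.length` the uniform parametrisation of `l ++ l'` is that of `l'`, started at
the last vertex of `a :: l` and shifted in time by `l.length`. [folklore] -/
theorem uniform_append_of_length_le : ∀ (l l' : List E) (a : E) {s : ℝ}, (l.length : ℝ) ≤ s →
    uniform a (l ++ l') s = uniform ((a :: l).getLast (List.cons_ne_nil a l)) l' (s - l.length)
  | [], l', a, s, _ => by simp
  | b :: l, l', a, s, hs => by
      rw [List.cons_append, uniform_cons]
      simp only [List.length_cons, Nat.cast_add, Nat.cast_one] at hs ⊢
      split_ifs with h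
      · -- `l = []` and `s = 1`
        have hl : l.length = 0 := by
          by_contra hne
          have : (1 : ℝ) ≤ l.length := by exact_mod_cast Nat.one_le_iff_ne_zero.2 hne
          linarith
        have hl' : l = [] := List.length_eq_zero_iff.1 hl
        subst hl'
        have hs1 : s = 1 := le_antisymm h (by simpa using hs)
        subst hs1
        simp
      · rw [uniform_append_of_length_le l l' b (s := s - 1) (by linarith),
          List.getLast_cons (List.cons_ne_nil b l)]
        congr 1
        ring

/-- A uniform polyline whose vertices lie in a convex set stays in it. [folklore] -/
theorem uniform_mem_of_convex {C : Set E} (hC : Convex ℝ C) :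
    ∀ (l : List E) (a : E), a ∈ C → (∀ x ∈ l, x ∈ C) → ∀ s : ℝ, uniform a l s ∈ C
  | [], a, ha, _, s => by simpa using ha
  | b :: l, a, ha, hl, s => by
      rw [uniform_cons]
      have hb : b ∈ C := hl b (by simp)
      split_ifs with h
      · have hmem : (Path.segment a b).extend s ∈ range (Path.segment a b) := by
          rw [← Path.extend_range]; exact ⟨s, rfl⟩
        rw [Path.range_segment] at hmem
        exact hC.segment_subset ha hb hmem
      · exact uniform_mem_of_convex hC l b hb (fun x hx => hl x (by simp [hx])) (s - 1)

end Uniform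

section Normed

variable {E : Type*} [NormedAddCommGroup E] [NormedSpace ℝ E]

/-- **A polyline is within `d` of its middle piece, modulo reparametrisation**, as soon as the
removed prefix vertices are within `d` of the first vertex of the middle piece and the removed
suffix vertices are within `d` of its last vertex. [folklore] -/
theorem dist_mk_polyline_append_le {P M S : List E} (hM : M ≠ []) {d : ℝ} (hd : 0 ≤ d)
    (hP : ∀ x ∈ P, dist x (M.head hM) ≤ d) (hS : ∀ x ∈ S, dist x (M.getLast hM) ≤ d) :
    dist (CurveClass.mk ⟨polyline (P ++ M ++ S)⟩) (CurveClass.mk ⟨polyline M⟩) ≤ d := by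
  obtain ⟨q, m, rfl⟩ := List.exists_cons_of_ne_nil hM
  simp only [List.head_cons] at hP
  set q' := (q :: m).getLast hM with hq'
  set n : ℕ := m.length with hn
  set k : ℕ := P.length with hk
  -- the long list as `a :: l` with `l = P' ++ [q] ++ (m ++ S)`-type decomposition
  obtain ⟨a, l, hal, hl⟩ : ∃ (a : E) (l : List E), P ++ (q :: m) ++ S = a :: l ∧
      (∀ s : ℝ, (k : ℝ) ≤ s → uniform a l s = uniform q (m ++ S) (s - k)) ∧
      (∀ s : ℝ, s ≤ k → uniform a l s ∈ closedBall q d) := by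
    rcases P with _ | ⟨a, P'⟩
    · refine ⟨q, m ++ S, by simp, fun s _ => by simp [hk], fun s hs => ?_⟩
      have hs0 : s ≤ 0 := by simpa [hk] using hs
      rw [uniform_of_nonpos _ _ hs0]
      exact mem_closedBall_self hd
    · refine ⟨a, (P' ++ [q]) ++ (m ++ S), by simp, fun s hs => ?_, fun s hs => ?_⟩
      · have hlen : ((P' ++ [q]).length : ℝ) = k := by simp [hk]
        rw [uniform_append_of_length_le (P' ++ [q]) (m ++ S) a (by rw [hlen]; exact hs), hlen]
        congr 1
        simp
      · have hlen : ((P' ++ [q]).length : ℝ) = k := by simp [hk]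
        rw [uniform_append_of_le (P' ++ [q]) (m ++ S) a (by rw [hlen]; exact hs)]
        refine uniform_mem_of_convex (convex_closedBall q d) _ a ?_ ?_ s
        · exact mem_closedBall.2 (hP a (by simp))
        · intro x hx
          simp only [List.mem_append, List.mem_singleton] at hx
          rcases hx with hx | rfl
          · exact mem_closedBall.2 (hP x (by simp [hx]))
          · exact mem_closedBall_self hd
  rw [hal]
  -- lengths
  have hlen : (l.length : ℝ) = k + n + S.length := by
    have := congrArg List.length hal
    simp only [List.length_append, List.length_cons] at this
    have h' : l.length = k + n + S.length := by rw [hk, hn]; omega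
    rw [h']; push_cast; ring
  -- the middle curve run with the clamped clock of the long list
  set V : ℝ → E := uniform q m with hV
  set h₁ : ℝ → ℝ := fun t => min (n : ℝ) (max 0 (clock l.length t - k)) with hh₁
  have hh₁c : Continuous h₁ := by
    have := continuous_clock l.length
    simp only [hh₁]
    fun_prop
  have hh₁m : Monotone h₁ := fun s t hst =>
    min_le_min_left _ (max_le_max_left _ (sub_le_sub_right (monotone_clock _ hst) _))
  let γ₃ : Curve E := ⟨⟨fun t : I => V (h₁ t), (continuous_uniform m q).comp
    (hh₁c.comp continuous_subtype_val)⟩⟩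
  have hγ₃ : ∀ t : I, γ₃ t = V (h₁ t) := fun _ => rfl
  -- `γ₃` is a monotone reparametrisation of `polyline (q :: m)`
  have h3 : CurveClass.mk γ₃ = CurveClass.mk ⟨polyline (q :: m)⟩ := by
    rw [CurveClass.mk_eq_mk]
    refine Curve.reparamDist_eq_zero_of_monotone' (m := (n : ℝ)) (Nat.cast_nonneg n)
      (V := V) (continuous_uniform m q).continuousOn hh₁c (continuous_clock n) hh₁m
      (monotone_clock n) ?_ (clock_zero n) ?_ (clock_one n) hγ₃ ?_
    · simp [hh₁]
    · simp only [hh₁, clock_one, hlen]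
      have hS0 : (0 : ℝ) ≤ S.length := Nat.cast_nonneg _
      have hn0 : (0 : ℝ) ≤ n := Nat.cast_nonneg _
      rw [max_eq_right (by linarith), min_eq_left (by linarith)]
    · intro t
      exact polyline_apply_eq_uniform_clock q m t
  rw [← h3, CurveClass.dist_mk_mk]
  refine (Curve.dist_le_dist_toContinuousMap _ _).trans ((ContinuousMap.dist_le hd).2 fun t => ?_)
  change dist (polyline (a :: l) t) (V (h₁ t)) ≤ d
  rw [polyline_apply_eq_uniform_clock a l t]
  set s : ℝ := clock l.length t with hs
  have hs0 : 0 ≤ s := (clock_mem_Icc l.length ⟨t.2.1, t.2.2⟩).1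
  have hs1 : s ≤ l.length := (clock_mem_Icc l.length ⟨t.2.1, t.2.2⟩).2
  simp only [hh₁]
  rcases le_or_gt s k with hsk | hsk
  · -- prefix: the long polyline is in the `d`-ball about `q`, the middle curve rests at `q`
    have hmin : min (n : ℝ) (max 0 (s - k)) = 0 := by
      rw [max_eq_left (by linarith), min_eq_right (Nat.cast_nonneg n)]
    rw [hmin, hV, uniform_zero]
    exact mem_closedBall.1 (hl.2 s hsk)
  rcases le_or_gt (s - k) n with hsn | hsn
  · -- middle window: the two runs agree
    have hmin : min (n : ℝ) (max 0 (s - k)) = s - k := by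
      rw [max_eq_right (by linarith), min_eq_right hsn]
    rw [hmin, hl.1 s hsk.le, hV, uniform_append_of_le m S q hsn, dist_self]
    exact hd
  · -- suffix: the long polyline is in the `d`-ball about `q'`, the middle curve rests at `q'`
    have hmin : min (n : ℝ) (max 0 (s - k)) = n := by
      rw [max_eq_right (by linarith), min_eq_left hsn.le]
    rw [hmin, hl.1 s hsk.le, hV, uniform_of_length_le m q (by rw [hn]),
      uniform_append_of_length_le m S q (by rw [← hn]; exact hsn.le)]
    refine mem_closedBall.1 (uniform_mem_of_convex (convex_closedBall _ d) S _
      (mem_closedBall_self hd) (fun x hx => mem_closedBall.2 ?_) _)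
    exact hS x hx
end Normed


section Stub

/-- **Registered sub-goal `stub_polylineMiddlePiece` of the gate transfer** (self-contained
form of `dist_mk_polyline_append_le`): a polyline is within `d` of its middle piece modulo
reparametrisation when the removed prefix (suffix) vertices are within `d` of the first (last)
vertex of the middle piece. -/
theorem stub_polylineMiddlePiece : ∀ {E : Type*} [NormedAddCommGroup E] [NormedSpace ℝ E] (P M S : List E) (hM : M ≠ []) (d : ℝ), 0 ≤ d → (∀ x ∈ P, dist x (M.head hM) ≤ d) → (∀ x ∈ S, dist x (M.getLast hM) ≤ d) → dist (Literature.Probability.RandomPlanarGeometry.CurveClass.mk ⟨Literature.Probability.LatticeModels.polyline (P ++ M ++ S)⟩) (Literature.Probability.RandomPlanarGeometry.CurveClass.mk ⟨Literature.Probability.LatticeModels.polyline M⟩) ≤ d :=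
  fun _ _ _ hM _ hd hP hS => dist_mk_polyline_append_le hM hd hP hS

end Stub

end Summit.CriticalPhenomena.SAWScalingLimit.Theorems.ObservableToSLER.BridgeGate

end
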